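import Summits.QuantumFields.YangMills.Theorems.BalabanUVNodesPortS1JacPiecesDefs
import Summits.QuantumFields.YangMills.Theorems.BalabanUVNodesPortS1HalvesDefs

/-!
# K0⁷ — THE RECORD-SIDE FORMAT NAMES, EDITION 30 = FLUCTUATION CARRIERS, SOCKET (o1-ε)'s `hop`: THE COMPLEXIFIED `h`-EXTENSION — `coarseCoordC`, `recordLQtB0C`, `hopLinGraphC`
# (▶ porter PT-A-1 g9, nodeO STATUS 2026-08-31 l.5760: «`exists_Dt` takes ℂ-LINEAR `LQ : 𝒴 →ₗ[ℂ] 𝒳` (= your `recordLQtC` ✓) AND `hop : 𝒳 →ₗ[ℂ] 𝒴` — a COMPLEXIFIED `hopLinGraphC`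
# (extension by zero of `(recordLQtB0C Vk)⁻¹ *ᵥ coarseCoordC`) is needed by (o1-ε); yours to mint (S)»)

Cell `ym-nodeO-ideate` ∕ `ym-balaban-port`, DEFINER seat `ym-nodeO-def-1` (gen 39); `--kind definition --supports stmt-QuantumFields-20541 --as helper`; count-neutral.
[I] = [Balaban1987RG1].

WHY.  Lit's ✓`B12Lineariz267.exists_Dt` (the linearising translation `D̃` of p.267 — stage-2 socket (o1)) is stated over ℂ-linear `LQ` and `hop` («(hB)(b₀(c)) = h(c)B(c)», `LQ̃h = I`).
`LQ` is ed.29's ✓`recordLQtC`; this file mints the ℂ-linear twin of ▶ PT-A-1's real ✓`hopLinGraph` (`…PortS1HalvesDefs` :69): same support (the central-bond coordinates `(b₀(c), j)`),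
same block inverse (ed.15d's REAL `recordLQtB0 Vk`, complexified entrywise), the coarse field read through ▶ PT-A-1's trace-projected complex coordinates ✓`su2CoordCt` (ℂ-linear on all of
`M₂(ℂ)`, = the real `su2Coord` on `𝔰𝔲(2)`).

WHAT THIS FILE IS (definitions + support∕unfolding faces; NEW names; nothing earlier touched):
* §24p `coarseCoordC D := (c, j) ↦ su2CoordCt (D c) j` (+ `_add`, `_smul`, `_zero`); `recordLQtB0C Vk := (recordLQtB0 F k K Vk).map (algebraMap ℝ ℂ)` (the `b₀`-block `A₁` of `LQ̃`, complexified
  ENTRYWISE — ◆ g39 (R-k): its identification with the `b₀`-block of `recordLQtC`∕`jacBlockC` is ▶ PT-A-1's BRIDGE THEOREM (o1-β)₃, not a second object here); ★ `hopLinGraphC Vk :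
  (PBond (F.P K) (k+1) → MatA 2) →ₗ[ℂ] (FluctIdx F k K → ℂ)`, `D ↦ (i ↦ ((recordLQtB0C Vk)⁻¹ *ᵥ coarseCoordC D)(c, i.2))` on `i.1 = b₀(c)`, `0` off `range recordB0` — VERBATIM the shape of
  `hopLinGraph` :69–:80 over ℂ; faces `hopLinGraphC_apply_of_mem`∕`_of_not_mem`.  JUNK (said, as for `hopLinGraph`): the nonsingular inverse is Mathlib's (adjugate∕det, `0`-junk when
  singular) — meaningful UNDER `RecordB0BlockInvertible`, displayed by consumers.
NOT HERE ((o1-β)₃∕(o1-δ)∕(o1-ε), ▶ PT-A-1's): `hopLinGraphC ∘ (ofReal-fields) = ↑hopLinGraph`, `recordLQtC ∘ hopLinGraphC = id` on the `b₀`-block, `‖hopLinGraphC‖ ≤ b`, `exists_Dt`.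

HONEST FRAMING.  Definitions only; NOTHING of Bałaban is asserted, ported or discharged; (o1) proper, (o3), `recordFluctInt` NOT in the tree; `stub_FE` (XXL) ∕ `stub_P0C` OPEN, ⟨27930⟩ OPEN
(1∕3); K0⁷ ∕ K0ᴬ ∕ K1ᴬ ∕ K3ᴬ OPEN; NODE O 0∕1; COUNT 8∕28 · K 1∕4 UNMOVED; finite `𝕋⁴_{L^K}` at fixed ε — NOT continuum ∕ ℝ⁴ ∕ OS; **the Yang–Mills mass gap (Clay) is NOT proved by any of
this.**  No `sorry`, `instance`, `notation`; standard axioms.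
-/

noncomputable section

open scoped BigOperators Matrix.Norms.L2Operator

namespace Summit.QuantumFields.YangMills.Theorems.K0RecordFormatNames

open Literature.MathematicalPhysics.QuantumFieldTheory.Balaban1983to89
open Literature.MathematicalPhysics.QuantumFieldTheory.Balaban1983to89.Node00
open Literature.MathematicalPhysics.QuantumFieldTheory.Balaban1983to89.T4Continuum (T4Family)
open Summit.QuantumFields.YangMills.Theorems.BalabanUVNodesPortS1 (su2CoordCt)
open _root_.Matrix

variable (F : T4Family)

/-! ## §24p  The complexified `h`-extension -/

/-- **Complex 𝔰𝔩(2)-coordinates of a coarse bond-matrix field** (`CoarseIdx`-vector): `coarseCoordC D (c, j) := su2CoordCt (D c) j` — ▶ PT-A-1's trace-projected reader, ℂ-linear on all of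
`M₂(ℂ)`; the complex twin of ✓`coarseCoord` (`…PortS1HalvesDefs`). [cite: Balaban1987RG1, p.267 (bookkeeping), (1.10) p.262] -/
def coarseCoordC (k K : ℕ) (D : PBond (F.P K) (k + 1) → MatA 2) : CoarseIdx F k K → ℂ :=
  fun cj => su2CoordCt (D cj.1) cj.2

/-- `coarseCoordC` is additive. [folklore] -/
theorem coarseCoordC_add (k K : ℕ) (D D' : PBond (F.P K) (k + 1) → MatA 2) :
    coarseCoordC F k K (D + D') = coarseCoordC F k K D + coarseCoordC F k K D' := by
  funext ⟨c, j⟩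
  fin_cases j <;> simp [coarseCoordC, su2CoordCt] <;> ring

/-- `coarseCoordC` is ℂ-homogeneous. [folklore] -/
theorem coarseCoordC_smul (k K : ℕ) (t : ℂ) (D : PBond (F.P K) (k + 1) → MatA 2) :
    coarseCoordC F k K (t • D) = t • coarseCoordC F k K D := by
  funext ⟨c, j⟩
  fin_cases j <;> simp [coarseCoordC, su2CoordCt] <;> ring

/-- `coarseCoordC 0 = 0`. [folklore] -/
theorem coarseCoordC_zero (k K : ℕ) : coarseCoordC F k K (0 : PBond (F.P K) (k + 1) → MatA 2) = 0 := by
  funext ⟨c, j⟩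
  fin_cases j <;> simp [coarseCoordC, su2CoordCt]

/-- **The `b₀`-block `A₁` of `LQ̃`, complexified ENTRYWISE**: `recordLQtB0C F k K Vk := (recordLQtB0 F k K Vk).map (algebraMap ℝ ℂ)` (ed.15d's real block read in `ℂ`; its identification with the
`b₀`-block of ✓`recordLQtC` ∕ ✓`jacBlockC` is a BRIDGE THEOREM of the consumer, ◆ g39 (R-k)). [cite: Balaban1987RG1, p.267 («h(c) … an inverse of a coefficient at the variable B′(b₀(c))»)] -/
def recordLQtB0C (k K : ℕ) (Vk : GaugeField (F.P K) k (SU 2)) : Matrix (CoarseIdx F k K) (CoarseIdx F k K) ℂ :=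
  (recordLQtB0 F k K Vk).map (algebraMap ℝ ℂ)

/-- Unfolding (`rfl`). [cite: Balaban1987RG1, p.267 (bookkeeping)] -/
theorem recordLQtB0C_apply (k K : ℕ) (Vk : GaugeField (F.P K) k (SU 2)) (i j : CoarseIdx F k K) :
    recordLQtB0C F k K Vk i j = ((recordLQtB0 F k K Vk i j : ℝ) : ℂ) := rfl

open Classical in
/-- ★ **THE COMPLEXIFIED `h`-EXTENSION — `hopLinGraphC F k K Vk : (PBond (F.P K) (k+1) → MatA 2) →ₗ[ℂ] (FluctIdx F k K → ℂ)`**: `D ↦` the complex fluctuation vector supported on the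
central-bond coordinates `(b₀(c), j)` with values `((recordLQtB0C Vk)⁻¹ *ᵥ coarseCoordC D)(c, j)` — print's «(hB)(b₀(c)) = h(c)B(c)», the ℂ-linear twin of ▶ PT-A-1's ✓`hopLinGraph` (same shape,
`ℝ ↦ ℂ`), the `hop : 𝒳 →ₗ[ℂ] 𝒴` input of ✓`B12Lineariz267.exists_Dt`.  JUNK (said): the nonsingular inverse is `0`-junk off `RecordB0BlockInvertible` — meaningful under that letter only.
[cite: Balaban1987RG1, p.267 («LQ̃h = I», «(hB)(b₀(c)) = h(c)B(c)»)] -/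
def hopLinGraphC (k K : ℕ) (Vk : GaugeField (F.P K) k (SU 2)) : (PBond (F.P K) (k + 1) → MatA 2) →ₗ[ℂ] (FluctIdx F k K → ℂ) where
  toFun D i := if h : i.1 ∈ Set.range (recordB0 F k K) then ((recordLQtB0C F k K Vk)⁻¹ *ᵥ coarseCoordC F k K D) (h.choose, i.2) else 0
  map_add' D D' := by
    funext i
    by_cases h : i.1 ∈ Set.range (recordB0 F k K)
    · simp only [dif_pos h, coarseCoordC_add, Matrix.mulVec_add, Pi.add_apply]
    · simp only [dif_neg h, Pi.add_apply, add_zero]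
  map_smul' t D := by
    funext i
    by_cases h : i.1 ∈ Set.range (recordB0 F k K)
    · simp only [dif_pos h, coarseCoordC_smul, Matrix.mulVec_smul, Pi.smul_apply, RingHom.id_apply]
    · simp only [dif_neg h, Pi.smul_apply, smul_zero, RingHom.id_apply]

open Classical in
/-- FACE: ON a central-bond row the value is the block-inverse reading. [cite: Balaban1987RG1, p.267 (bookkeeping)] -/
theorem hopLinGraphC_apply_of_mem (k K : ℕ) (Vk : GaugeField (F.P K) k (SU 2)) (D : PBond (F.P K) (k + 1) → MatA 2) (i : FluctIdx F k K)
    (h : i.1 ∈ Set.range (recordB0 F k K)) :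
    hopLinGraphC F k K Vk D i = ((recordLQtB0C F k K Vk)⁻¹ *ᵥ coarseCoordC F k K D) (h.choose, i.2) := by
  show (if h : i.1 ∈ Set.range (recordB0 F k K) then ((recordLQtB0C F k K Vk)⁻¹ *ᵥ coarseCoordC F k K D) (h.choose, i.2) else 0) = _
  rw [dif_pos h]

open Classical in
/-- FACE: OFF the central bonds the value is `0` (extension by zero). [cite: Balaban1987RG1, p.267 (bookkeeping)] -/
theorem hopLinGraphC_apply_of_not_mem (k K : ℕ) (Vk : GaugeField (F.P K) k (SU 2)) (D : PBond (F.P K) (k + 1) → MatA 2) (i : FluctIdx F k K)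
    (h : i.1 ∉ Set.range (recordB0 F k K)) : hopLinGraphC F k K Vk D i = 0 := by
  show (if h : i.1 ∈ Set.range (recordB0 F k K) then ((recordLQtB0C F k K Vk)⁻¹ *ᵥ coarseCoordC F k K D) (h.choose, i.2) else 0) = _
  rw [dif_neg h]

end Summit.QuantumFields.YangMills.Theorems.K0RecordFormatNames

end
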